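import Mathlib
import HarnessLib
import Summits.QuantumFields.YangMills.Theorems.LangevinControlUVFemtoCurvatureSkewnessTreeRatioFloorBinomial
import Summits.QuantumFields.YangMills.Theorems.LangevinControlUVFemtoCurvatureSkewnessTreeRatioFloorBlock
import Summits.QuantumFields.YangMills.Theorems.LangevinControlUVFemtoCurvatureSkewnessTreeRatioFloorKernel
import Summits.QuantumFields.YangMills.Theorems.LangevinControlUVFemtoCurvatureSkewnessTreeRatioFloorKernelBounds
import Summits.QuantumFields.YangMills.Theorems.LangevinControlUVFemtoCurvatureSkewnessTreeRatioFloorMomentum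
import Summits.QuantumFields.YangMills.Theorems.LangevinControlUVFemtoCurvatureSkewnessTreeRatioFloorMass
import Summits.QuantumFields.YangMills.Theorems.LangevinControlUVFemtoCurvatureSkewnessTreeRatioFloorExpansion

/-!
# `FemtoCurvatureSkewness` — the two series of the ratio floor (stub `TreeRatioFloor`, crux stmt-QuantumFields-9365)

With the lazy-walk expansion `F(x) = Σ_m L² D(m) E_m(x)` of the sliced transverse torus propagator
(`TreeRatio.hasSum_propF`): the diagonal value is large, `F(-n,n) ≥ cLow L⁴/n⁴` (`le_propF_diag`: window
`3n² ≤ m ≤ 4n²`, central block `n² ≤ i ≤ m-n²`, kernel ratio floor and `D(m) ≳ L²/m²`); the axis weights split as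
`E_m(n,0) = EI_m + EII_m` according to `m - i ≥ n²` or not, with `EI_m ≤ e⁴ E_m(-n,n)` (`lazyEI_le`) and, for short
walks `m < 4n²`, `L² D(m) EII_m ≤ 2611200 L⁴/n⁶` (`remainder_small`: Gaussian kernel bound and `D(m) ≲ L²/m²`).
The constants `cLow`, `rTail`, `cHigh`, `ρ₀ = (e⁴ + cHigh/cLow)⁻¹` of the stub are defined here.  Mathlib only.
-/

noncomputable section

namespace Summit.QuantumFields.YangMills.Theorems.FemtoCurvatureSkewness

open Finset
open scoped BigOperators

namespace TreeRatio

/-! ## Constants -/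

/-- Lower constant: `G_d ≥ cLow · L⁴/n⁴`. -/
def cLow : ℝ := Real.exp (-(Real.pi ^ 2 / 4)) / 2048 * Real.exp (-8) / 512

/-- Decay rate of the binomial quarter tail (`< 1`). -/
def rTail : ℝ := 2 * quarterRoot / 3

/-- Upper constant: the axis terms with `m - i < n²` sum to at most `cHigh · L⁴/n⁴`. -/
def cHigh : ℝ := 10444800 + 1 / (8 * Real.log rTail ^ 2 * (1 - rTail))

/-- **The ratio floor constant** `ρ₀ = (e⁴ + cHigh/cLow)⁻¹`. -/
def rho0 : ℝ := (Real.exp 4 + cHigh / cLow)⁻¹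

/-- `cLow > 0`. -/
theorem cLow_pos : 0 < cLow := by unfold cLow; positivity

/-- `0 < rTail`. -/
theorem rTail_pos : 0 < rTail := by unfold rTail; have := quarterRoot_pos; positivity

/-- `rTail < 1`. -/
theorem rTail_lt_one : rTail < 1 := by
  unfold rTail; have := two_mul_quarterRoot_lt_three; linarith

/-- `log rTail < 0`. -/
theorem log_rTail_neg : Real.log rTail < 0 := Real.log_neg rTail_pos rTail_lt_one

/-- `cHigh > 0`. -/
theorem cHigh_pos : 0 < cHigh := by
  unfold cHigh
  have h1 : 0 < Real.log rTail ^ 2 := by have := log_rTail_neg; nlinarith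
  have h2 : 0 < 1 - rTail := by have := rTail_lt_one; linarith
  have h3 : 0 < 1 / (8 * Real.log rTail ^ 2 * (1 - rTail)) := div_pos one_pos (mul_pos (mul_pos (by norm_num) h1) h2)
  linarith

/-- `ρ₀ > 0`. -/
theorem rho0_pos : 0 < rho0 := by
  unfold rho0; have := cHigh_pos; have := cLow_pos; positivity

/-- `e^{-x} ≤ k!/x^k` for `x > 0`. -/
theorem exp_neg_le_factorial_div_pow {x : ℝ} (hx : 0 < x) (k : ℕ) : Real.exp (-x) ≤ (k.factorial : ℝ) / x ^ k := by
  have h := Real.pow_div_factorial_le_exp x hx.le k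
  rw [Real.exp_neg, inv_eq_one_div, div_le_div_iff₀ (Real.exp_pos x) (by positivity), one_mul]
  rw [div_le_iff₀ (by positivity)] at h
  linarith

variable (L : ℕ) [NeZero L]

/-! ## The diagonal series is large -/

/-- **Lower bound on the diagonal propagator**: `cLow L⁴/n⁴ ≤ F(-n, n)` for `1 ≤ n`, `8n ≤ L`. -/
theorem le_propF_diag {n : ℕ} (hn : 1 ≤ n) (hnL : 8 * n ≤ L) :
    cLow * (L : ℝ) ^ 4 / (n : ℝ) ^ 4 ≤ propF L (-(n : ℤ), (n : ℤ)) := by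
  have hnr : (1 : ℝ) ≤ n := by exact_mod_cast hn
  have hL2 : 64 * n ^ 2 ≤ L ^ 2 := by nlinarith
  have h2n : 2 * n ≤ L := by omega
  -- termwise lower bound in the window `3n² ≤ m ≤ 4n²`
  have hwin : ∀ m ∈ Icc (3 * n ^ 2) (4 * n ^ 2),
      cLow * (L : ℝ) ^ 4 / (n : ℝ) ^ 6 ≤ (L : ℝ) ^ 2 * massD L m * lazyE L m (-(n : ℤ), (n : ℤ)) := by
    intro m hm
    rw [mem_Icc] at hm
    have hm1 : 1 ≤ m := le_trans (by nlinarith) hm.1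
    have hmr : (3 : ℝ) * n ^ 2 ≤ m := by exact_mod_cast hm.1
    have hmr' : (m : ℝ) ≤ 4 * n ^ 2 := by exact_mod_cast hm.2
    have hmpos : (0 : ℝ) < m := by positivity
    -- mass weights
    have hD : Real.exp (-(Real.pi ^ 2 / 4)) / 2048 * (L : ℝ) ^ 2 / (m : ℝ) ^ 2 ≤ massD L m :=
      le_massD L hm1 (by nlinarith [hm.2])
    -- the lazy weights: central block
    have hE : Real.exp (-8) / (8 * m) ≤ lazyE L m (-(n : ℤ), (n : ℤ)) := by
      have hblock := block_sum_ge m (n ^ 2) (by omega)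
      have hterm : ∀ i ∈ Icc (n ^ 2) (m - n ^ 2), (m.choose i : ℝ) / 2 ^ m * (Real.exp (-8) / (2 * m)) ≤
          (m.choose i : ℝ) / 2 ^ m * lam L i (-(n : ℤ)) * lam L (m - i) (n : ℤ) := by
        intro i hi
        rw [mem_Icc] at hi
        have hi1 : 1 ≤ i := le_trans (by nlinarith) hi.1
        have hj1 : 1 ≤ m - i := le_trans (by nlinarith) (by omega : n ^ 2 ≤ m - i)
        have hli : Real.exp (-4) * (((2 * i).choose i : ℝ) / 4 ^ i) ≤ lam L i (-(n : ℤ)) := by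
          rw [lam_neg]
          have h1 := choose_div_le_lam L (i := i) (v := n) (by nlinarith)
          have h2 := choose_center_le_exp_four_mul (i := i) hn hi.1
          calc Real.exp (-4) * (((2 * i).choose i : ℝ) / 4 ^ i) ≤ ((2 * i).choose (i + n) : ℝ) / 4 ^ i := by
                rw [mul_div_assoc', div_le_div_iff_of_pos_right (by positivity), Real.exp_neg,
                  inv_mul_le_iff₀ (Real.exp_pos 4)]
                exact h2
            _ ≤ lam L i n := h1
        have hlj : Real.exp (-4) * (((2 * (m - i)).choose (m - i) : ℝ) / 4 ^ (m - i)) ≤ lam L (m - i) (n : ℤ) := by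
          have h1 := choose_div_le_lam L (i := m - i) (v := n) (by nlinarith [(by omega : n ^ 2 ≤ m - i)])
          have h2 := choose_center_le_exp_four_mul (i := m - i) hn (by omega)
          calc Real.exp (-4) * (((2 * (m - i)).choose (m - i) : ℝ) / 4 ^ (m - i))
              ≤ ((2 * (m - i)).choose (m - i + n) : ℝ) / 4 ^ (m - i) := by
                rw [mul_div_assoc', div_le_div_iff_of_pos_right (by positivity), Real.exp_neg,
                  inv_mul_le_iff₀ (Real.exp_pos 4)]
                exact h2
            _ ≤ lam L (m - i) n := h1
        have hpp := centralWeight_mul_ge hi1 hj1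
        have hsum : ((i : ℝ) + (m - i : ℕ)) = m := by rw [Nat.cast_sub (by omega)]; ring
        rw [hsum] at hpp
        have he8 : Real.exp (-8) = Real.exp (-4) * Real.exp (-4) := by rw [← Real.exp_add]; norm_num
        calc (m.choose i : ℝ) / 2 ^ m * (Real.exp (-8) / (2 * m))
            = (m.choose i : ℝ) / 2 ^ m * (Real.exp (-4) * Real.exp (-4) * (1 / (2 * m))) := by rw [he8]; ring
          _ ≤ (m.choose i : ℝ) / 2 ^ m * (Real.exp (-4) * Real.exp (-4) *
              (((2 * i).choose i : ℝ) / 4 ^ i * (((2 * (m - i)).choose (m - i) : ℝ) / 4 ^ (m - i)))) := by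
              gcongr
          _ = (m.choose i : ℝ) / 2 ^ m * (Real.exp (-4) * (((2 * i).choose i : ℝ) / 4 ^ i)) *
              (Real.exp (-4) * (((2 * (m - i)).choose (m - i) : ℝ) / 4 ^ (m - i))) := by ring
          _ ≤ (m.choose i : ℝ) / 2 ^ m * lam L i (-(n : ℤ)) * lam L (m - i) (n : ℤ) :=
              mul_le_mul (mul_le_mul_of_nonneg_left hli (by positivity)) hlj
                (mul_nonneg (Real.exp_pos _).le (by positivity)) (mul_nonneg (by positivity) (lam_nonneg L _ _))
      have hsub : Icc (n ^ 2) (m - n ^ 2) ⊆ range (m + 1) := by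
        intro i hi; rw [mem_Icc] at hi; exact mem_range.mpr (by omega)
      calc Real.exp (-8) / (8 * m) ≤ ((m : ℝ) - 2 * (n ^ 2 : ℕ) + 1) / ((m : ℝ) + 1) * (Real.exp (-8) / (2 * m)) := by
            rw [div_mul_div_comm, div_le_div_iff₀ (by positivity) (by positivity)]
            push_cast
            have h4 : (m : ℝ) + 1 ≤ 4 * ((m : ℝ) - 2 * n ^ 2 + 1) := by nlinarith
            calc Real.exp (-8) * ((↑m + 1) * (2 * ↑m)) = (Real.exp (-8) * (2 * m)) * ((m : ℝ) + 1) := by ring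
              _ ≤ (Real.exp (-8) * (2 * m)) * (4 * ((m : ℝ) - 2 * n ^ 2 + 1)) :=
                  mul_le_mul_of_nonneg_left h4 (by positivity)
              _ = ((m : ℝ) - 2 * n ^ 2 + 1) * Real.exp (-8) * (8 * m) := by ring
        _ ≤ (∑ i ∈ Icc (n ^ 2) (m - n ^ 2), (m.choose i : ℝ) / 2 ^ m) * (Real.exp (-8) / (2 * m)) := by
            gcongr
            rw [div_le_iff₀ (by positivity), ← sum_div, div_mul_eq_mul_div, le_div_iff₀ (by positivity)]
            linarith [hblock]
        _ = ∑ i ∈ Icc (n ^ 2) (m - n ^ 2), (m.choose i : ℝ) / 2 ^ m * (Real.exp (-8) / (2 * m)) := sum_mul _ _ _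
        _ ≤ ∑ i ∈ Icc (n ^ 2) (m - n ^ 2), (m.choose i : ℝ) / 2 ^ m * lam L i (-(n : ℤ)) * lam L (m - i) (n : ℤ) :=
            sum_le_sum hterm
        _ ≤ lazyE L m (-(n : ℤ), (n : ℤ)) := by
            unfold lazyE
            exact sum_le_sum_of_subset_of_nonneg hsub fun i _ _ =>
              mul_nonneg (mul_nonneg (by positivity) (lam_nonneg L _ _)) (lam_nonneg L _ _)
    -- combine
    calc cLow * (L : ℝ) ^ 4 / (n : ℝ) ^ 6
        ≤ (L : ℝ) ^ 2 * (Real.exp (-(Real.pi ^ 2 / 4)) / 2048 * (L : ℝ) ^ 2 / (m : ℝ) ^ 2) * (Real.exp (-8) / (8 * m)) := by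
          unfold cLow
          rw [div_le_iff₀ (by positivity)]
          have hm3 : (m : ℝ) ^ 3 ≤ 64 * (n : ℝ) ^ 6 := by nlinarith [pow_le_pow_left₀ hmpos.le hmr' 3]
          have key : (L : ℝ) ^ 2 * (Real.exp (-(Real.pi ^ 2 / 4)) / 2048 * (L : ℝ) ^ 2 / (m : ℝ) ^ 2) *
              (Real.exp (-8) / (8 * m)) * (n : ℝ) ^ 6 =
              Real.exp (-(Real.pi ^ 2 / 4)) / 2048 * Real.exp (-8) / 512 * (L : ℝ) ^ 4 * (64 * (n : ℝ) ^ 6 / (m : ℝ) ^ 3) := by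
            field_simp; ring
          rw [key]
          have h1 : (1 : ℝ) ≤ 64 * (n : ℝ) ^ 6 / (m : ℝ) ^ 3 := by rw [le_div_iff₀ (by positivity)]; linarith
          have h0 : 0 ≤ Real.exp (-(Real.pi ^ 2 / 4)) / 2048 * Real.exp (-8) / 512 * (L : ℝ) ^ 4 := by positivity
          nlinarith
      _ ≤ (L : ℝ) ^ 2 * massD L m * lazyE L m (-(n : ℤ), (n : ℤ)) := by
          gcongr
          · exact mul_nonneg (by positivity) (massD_nonneg L m)
  -- sum over the window
  have hcard : ((Icc (3 * n ^ 2) (4 * n ^ 2)).card : ℝ) = (n : ℝ) ^ 2 + 1 := by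
    rw [Nat.card_Icc]; push_cast [Nat.cast_sub (show 3 * n ^ 2 ≤ 4 * n ^ 2 + 1 by omega)]; ring
  calc cLow * (L : ℝ) ^ 4 / (n : ℝ) ^ 4 ≤ ((n : ℝ) ^ 2 + 1) * (cLow * (L : ℝ) ^ 4 / (n : ℝ) ^ 6) := by
        have hcl := cLow_pos
        have e : cLow * (L : ℝ) ^ 4 / (n : ℝ) ^ 4 = (n : ℝ) ^ 2 * (cLow * (L : ℝ) ^ 4 / (n : ℝ) ^ 6) := by
          field_simp
        rw [e]
        exact mul_le_mul_of_nonneg_right (by linarith) (by positivity)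
    _ = ∑ _m ∈ Icc (3 * n ^ 2) (4 * n ^ 2), cLow * (L : ℝ) ^ 4 / (n : ℝ) ^ 6 := by rw [sum_const, nsmul_eq_mul, hcard]
    _ ≤ ∑ m ∈ Icc (3 * n ^ 2) (4 * n ^ 2), (L : ℝ) ^ 2 * massD L m * lazyE L m (-(n : ℤ), (n : ℤ)) := sum_le_sum hwin
    _ ≤ propF L (-(n : ℤ), (n : ℤ)) :=
        sum_le_hasSum _ (fun m _ => mul_nonneg (mul_nonneg (by positivity) (massD_nonneg L m)) (lazyE_nonneg L m _))
          (hasSum_propF L _)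

/-! ## The axis series: the comparable part and the remainder -/

/-- The comparable part of the axis weights: indices with `m - i ≥ n²`. -/
def lazyEI (n m : ℕ) : ℝ :=
  ∑ i ∈ (range (m + 1)).filter (fun i => n ^ 2 ≤ m - i), (m.choose i : ℝ) / 2 ^ m * lam L i (n : ℤ) * lam L (m - i) 0

/-- The remainder of the axis weights: indices with `m - i < n²`. -/
def lazyEII (n m : ℕ) : ℝ :=
  ∑ i ∈ (range (m + 1)).filter (fun i => ¬ n ^ 2 ≤ m - i), (m.choose i : ℝ) / 2 ^ m * lam L i (n : ℤ) * lam L (m - i) 0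

omit [NeZero L] in
/-- The split `E_m(n,0) = EI + EII`. -/
theorem lazyE_axis_split (n m : ℕ) : lazyE L m ((n : ℤ), 0) = lazyEI L n m + lazyEII L n m := by
  unfold lazyE lazyEI lazyEII
  exact (sum_filter_add_sum_filter_not _ _ _).symm

omit [NeZero L] in
/-- `EI ≥ 0`. -/
theorem lazyEI_nonneg (n m : ℕ) : 0 ≤ lazyEI L n m :=
  sum_nonneg fun i _ => mul_nonneg (mul_nonneg (by positivity) (lam_nonneg L _ _)) (lam_nonneg L _ _)

omit [NeZero L] in
/-- `EII ≥ 0`. -/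
theorem lazyEII_nonneg (n m : ℕ) : 0 ≤ lazyEII L n m :=
  sum_nonneg fun i _ => mul_nonneg (mul_nonneg (by positivity) (lam_nonneg L _ _)) (lam_nonneg L _ _)

/-- **The comparable part**: `EI_m ≤ e⁴ E_m(-n, n)` (kernel ratio floor on the second factor). -/
theorem lazyEI_le {n : ℕ} (hn : 1 ≤ n) (h2n : 2 * n ≤ L) (m : ℕ) :
    lazyEI L n m ≤ Real.exp 4 * lazyE L m (-(n : ℤ), (n : ℤ)) := by
  unfold lazyEI lazyE
  rw [mul_sum]
  calc ∑ i ∈ (range (m + 1)).filter (fun i => n ^ 2 ≤ m - i), (m.choose i : ℝ) / 2 ^ m * lam L i (n : ℤ) * lam L (m - i) 0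
      ≤ ∑ i ∈ (range (m + 1)).filter (fun i => n ^ 2 ≤ m - i),
          Real.exp 4 * ((m.choose i : ℝ) / 2 ^ m * lam L i (-(n : ℤ)) * lam L (m - i) (n : ℤ)) := by
        refine sum_le_sum fun i hi => ?_
        have hi' : n ^ 2 ≤ m - i := (mem_filter.mp hi).2
        have h := lam_zero_le_exp_four_mul L (i := m - i) hn hi' h2n
        rw [lam_neg]
        calc (m.choose i : ℝ) / 2 ^ m * lam L i (n : ℤ) * lam L (m - i) 0
            ≤ (m.choose i : ℝ) / 2 ^ m * lam L i (n : ℤ) * (Real.exp 4 * lam L (m - i) (n : ℤ)) :=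
              mul_le_mul_of_nonneg_left h (mul_nonneg (by positivity) (lam_nonneg L _ _))
          _ = Real.exp 4 * ((m.choose i : ℝ) / 2 ^ m * lam L i (n : ℤ) * lam L (m - i) (n : ℤ)) := by ring
    _ ≤ ∑ i ∈ range (m + 1), Real.exp 4 * ((m.choose i : ℝ) / 2 ^ m * lam L i (-(n : ℤ)) * lam L (m - i) (n : ℤ)) :=
        sum_le_sum_of_subset_of_nonneg (filter_subset _ _) fun i _ _ =>
          mul_nonneg (Real.exp_pos _).le (mul_nonneg (mul_nonneg (by positivity) (lam_nonneg L _ _)) (lam_nonneg L _ _))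

/-- **The remainder for short walks** (`1 ≤ m < 4n²`): `L² D(m) EII_m ≤ 2611200 L⁴/n⁶`. -/
theorem remainder_small {n m : ℕ} (hn : 1 ≤ n) (hnL : 8 * n ≤ L) (hm : m < 4 * n ^ 2) :
    (L : ℝ) ^ 2 * massD L m * lazyEII L n m ≤ 2611200 * (L : ℝ) ^ 4 / (n : ℝ) ^ 6 := by
  have hnr : (1 : ℝ) ≤ n := by exact_mod_cast hn
  rcases Nat.eq_zero_or_pos m with h0 | hm1
  · -- `m = 0`: the term vanishes (`λ_0(n) = 0`)
    subst h0
    have hE : lazyEII L n 0 = 0 := by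
      unfold lazyEII
      refine sum_eq_zero fun i hi => ?_
      have hi0 : i = 0 := by have := (mem_filter.mp hi).1; rw [mem_range] at this; omega
      subst hi0
      rw [lam_eq_zero_of_lt L (by exact_mod_cast hn)
        (by have h' : ((n : ℕ) : ℤ) < L := by exact_mod_cast (show n < L by omega)
            push_cast; linarith)]
      ring
    rw [hE, mul_zero]
    positivity
  have hmr : (0 : ℝ) < m := by exact_mod_cast hm1
  have hmL : m ≤ L ^ 2 := by nlinarith
  have hD := massD_le L hm1 hmL
  -- the Gaussian bound on `EII ≤ E ≤ 32 e^{-n²/2m}/(m+1)`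
  have hy : 2 * |((n : ℕ) : ℤ)| ≤ L := by rw [Nat.abs_cast]; exact_mod_cast (show 2 * n ≤ L by omega)
  have hE : lazyEII L n m ≤ 32 * Real.exp (-((n : ℝ) ^ 2) / (2 * m)) / ((m : ℝ) + 1) := by
    have hterm : ∀ i ∈ range (m + 1), (m.choose i : ℝ) / 2 ^ m * lam L i (n : ℤ) * lam L (m - i) 0 ≤
        16 * Real.exp (-((n : ℝ) ^ 2) / (2 * m)) * ((m.choose i : ℝ) * (((2 * i).choose i : ℝ) / 4 ^ i) *
          (((2 * (m - i)).choose (m - i) : ℝ) / 4 ^ (m - i))) / 2 ^ m := by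
      intro i hi
      have him : i ≤ m := Nat.lt_succ_iff.mp (mem_range.mp hi)
      -- second factor: `λ_{m-i}(0) ≤ 4 p_{m-i}`
      have h2 : lam L (m - i) 0 ≤ 4 * (((2 * (m - i)).choose (m - i) : ℝ) / 4 ^ (m - i)) := by
        have h := lam_le_gauss L (i := m - i) (y := 0) (by
          have : 16 * (m - i) ≤ 16 * m := by omega
          nlinarith) (by simp)
        simpa using h
      -- first factor: `λ_i(n) ≤ 4 p_i e^{-n²/2m}`
      have h1 : lam L i (n : ℤ) ≤ 4 * (((2 * i).choose i : ℝ) / 4 ^ i) * Real.exp (-((n : ℝ) ^ 2) / (2 * m)) := by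
        rcases Nat.eq_zero_or_pos i with hi0 | hipos
        · subst hi0
          rw [lam_eq_zero_of_lt L (by exact_mod_cast hn)
            (by have h' : ((n : ℕ) : ℤ) < L := by exact_mod_cast (show n < L by omega)
                push_cast; linarith)]
          positivity
        · have h := lam_le_gauss L (i := i) (y := (n : ℤ)) (by nlinarith) hy
          push_cast at h
          refine h.trans (mul_le_mul_of_nonneg_left (Real.exp_le_exp.mpr ?_) (by positivity))
          rw [neg_div, neg_div, neg_le_neg_iff]
          exact div_le_div_of_nonneg_left (by positivity) (by positivity) (by gcongr)
      calc (m.choose i : ℝ) / 2 ^ m * lam L i (n : ℤ) * lam L (m - i) 0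
          ≤ (m.choose i : ℝ) / 2 ^ m * (4 * (((2 * i).choose i : ℝ) / 4 ^ i) * Real.exp (-((n : ℝ) ^ 2) / (2 * m))) *
              (4 * (((2 * (m - i)).choose (m - i) : ℝ) / 4 ^ (m - i))) :=
            mul_le_mul (mul_le_mul_of_nonneg_left h1 (by positivity)) h2 (lam_nonneg L _ _) (by positivity)
        _ = _ := by ring
    calc lazyEII L n m ≤ lazyE L m ((n : ℤ), 0) := by
          rw [lazyE_axis_split]; linarith [lazyEI_nonneg L n m]
      _ ≤ ∑ i ∈ range (m + 1), 16 * Real.exp (-((n : ℝ) ^ 2) / (2 * m)) *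
            ((m.choose i : ℝ) * (((2 * i).choose i : ℝ) / 4 ^ i) * (((2 * (m - i)).choose (m - i) : ℝ) / 4 ^ (m - i))) /
            2 ^ m := sum_le_sum hterm
      _ = 16 * Real.exp (-((n : ℝ) ^ 2) / (2 * m)) * (∑ i ∈ range (m + 1),
            (m.choose i : ℝ) * (((2 * i).choose i : ℝ) / 4 ^ i) * (((2 * (m - i)).choose (m - i) : ℝ) / 4 ^ (m - i))) /
            2 ^ m := by rw [mul_sum, sum_div]
      _ ≤ 16 * Real.exp (-((n : ℝ) ^ 2) / (2 * m)) * (2 ^ (m + 1) / ((m : ℝ) + 1)) / 2 ^ m := by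
          gcongr; exact sum_choose_mul_centralWeight_le m
      _ = 32 * Real.exp (-((n : ℝ) ^ 2) / (2 * m)) / ((m : ℝ) + 1) := by rw [pow_succ]; field_simp; ring
  -- `e^{-n²/2m} ≤ 48 m³/n⁶`
  have hexp : Real.exp (-((n : ℝ) ^ 2) / (2 * m)) ≤ 48 * (m : ℝ) ^ 3 / (n : ℝ) ^ 6 := by
    have hx : 0 < (n : ℝ) ^ 2 / (2 * m) := by positivity
    have h := exp_neg_le_factorial_div_pow hx 3
    rw [neg_div]
    refine h.trans (le_of_eq ?_)
    simp only [Nat.factorial, Nat.succ_eq_add_one, Nat.reduceAdd, Nat.reduceMul, Nat.cast_ofNat]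
    field_simp
    ring
  calc (L : ℝ) ^ 2 * massD L m * lazyEII L n m
      ≤ (L : ℝ) ^ 2 * (1700 * (L : ℝ) ^ 2 / (m : ℝ) ^ 2) * (32 * Real.exp (-((n : ℝ) ^ 2) / (2 * m)) / ((m : ℝ) + 1)) :=
        mul_le_mul (mul_le_mul_of_nonneg_left hD (by positivity)) hE (lazyEII_nonneg L n m) (by positivity)
    _ ≤ (L : ℝ) ^ 2 * (1700 * (L : ℝ) ^ 2 / (m : ℝ) ^ 2) * (32 * (48 * (m : ℝ) ^ 3 / (n : ℝ) ^ 6) / (m : ℝ)) := by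
        gcongr
        linarith
    _ = 2611200 * (L : ℝ) ^ 4 / (n : ℝ) ^ 6 := by field_simp; ring

end TreeRatio

/-- **Lower bound on the diagonal propagator** (registered sub-goal `TreeRatioDiagLower`): `cLow L⁴/n⁴ ≤ F(-n, n)` for `1 ≤ n`, `8n ≤ L`, with `F` written out. -/
theorem TreeRatioDiagLower : ∀ (L : ℕ) [NeZero L] (n : ℕ), 1 ≤ n → 8 * n ≤ L → Real.exp (-(Real.pi ^ 2 / 4))
    / 2048 * Real.exp (-8) / 512 * (L : ℝ) ^ 4 / (n : ℝ) ^ 4 ≤ ∑ q : ZMod L × ZMod L, ∑ p : ZMod L × ZMod L,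
    ((2 - 2 * Real.cos (2 * Real.pi * (q.1.val : ℝ) / L)) + (2 - 2 * Real.cos (2 * Real.pi * (q.2.val : ℝ) /
    L))) / (((2 - 2 * Real.cos (2 * Real.pi * (q.1.val : ℝ) / L)) + (2 - 2 * Real.cos (2 * Real.pi * (q.2.val
    : ℝ) / L))) + (2 - 2 * Real.cos (2 * Real.pi * (p.1.val : ℝ) / L)) + (2 - 2 * Real.cos (2 * Real.pi *
    (p.2.val : ℝ) / L))) * Real.cos (2 * Real.pi * ((p.1.val : ℝ) * ((-(n : ℤ) : ℤ) : ℝ) + (p.2.val : ℝ) *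
    ((n : ℤ) : ℝ)) / L) :=
  fun L _ _ hn hnL => TreeRatio.le_propF_diag L hn hnL

end Summit.QuantumFields.YangMills.Theorems.FemtoCurvatureSkewness

end
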